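import Literature.Geometry.Lorentzian.CoordCurvatureNormSq
import HarnessLib

/-!
# Basis independence of the quadratic and cubic curvature trace invariants in coordinates

Static linear algebra for the coordinate tensor calculus of `CoordCurvature.lean` (metric components
`G : E → (E →L E →L ℝ)`, curvature endomorphism `R_x(X,Y) = MetricCoord.riemAt G x X Y`, inverse
metric coefficients `g^{ij} = MetricCoord.ginv G b x i j` in a basis `b`). The two full contractions

  `Q_b = Σ g^{aa'} g^{cc'} tr(R(b_a,b_c) ∘ R(b_{a'},b_{c'}))`                       (`= −|Rm|²_G`)
  `T_b = Σ g^{aa'} g^{cc'} g^{ee'} tr(R(b_a,b_c) ∘ (R(b_{c'},b_e) ∘ R(b_{e'},b_{a'})))`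

(the index pattern of `MetricCoord.quadTrace_pullMetric` / `MetricCoord.cubicTrace_pullMetric`,
`CoordRicciCovariance.lean`, and of the Kerr facts `Kerr.kretschmannScalar_closedForm`,
`KerrKretschmannScalar.lean`, and the cubic Weyl invariant hypothesis of
`…TameCensorshipPhaseRigidity.lean`) do **not depend on the basis** `b` (O'Neill 1983, Ch. 3,
pp. 60–61 and Lemma 3.36 ff.: a metric contraction `g^{ij} β_{ij} = tr(♯ ∘ β)` is a trace, hence
basis-free). The mechanism is the single lemma `sum_ginv_mul_eq_of_bilinear`: for a bilinear
`f`, `Σ_{ij} g^{ij} f(b_i, b_j) = tr_G f` (`MetricCoord.mtrAt_eq_sum`) for every basis; it is applied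
once per contracted pair, the remaining slots frozen. Used with the naturality lemmas
(`cubicTrace_pullMetric` transports `T` to the basis `Dψ_y b` of a chart; `cubicTrace_eq_of_basis`
then moves it to the coordinate basis in which closed forms are computed). Everything is proved;
no definitions are introduced.

## References

* B. O'Neill, *Semi-Riemannian geometry with applications to relativity*, Academic Press 1983,
  Ch. 3, pp. 60–61 (metric contraction), Lemma 3.36, Prop. 3.59. [ONeill1983]
-/

noncomputable section

set_option maxSynthPendingDepth 3

open Module
open scoped ContDiff

namespace Literature.Geometry.Lorentzian

namespace MetricCoord

variable {E : Type*} [NormedAddCommGroup E] [NormedSpace ℝ E] [FiniteDimensional ℝ E]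
  {ι ι' : Type*} [Fintype ι] [Fintype ι']
  (G : E → E →L[ℝ] E →L[ℝ] ℝ) (b : Basis ι ℝ E) (b' : Basis ι' ℝ E) (x : E)

/-- **A metric contraction does not depend on the basis**: for a bilinear real function `f`,
`Σ_{ij} g^{ij} f(b_i, b_j)` has the same value in any two bases (both equal `tr_G f`,
`mtrAt_eq_sum`). [cite: ONeill1983, Ch. 3, pp. 60–61] -/
theorem sum_ginv_mul_eq_of_bilinear (f : E → E → ℝ)
    (h₁ : ∀ Y₁ Y₂ Z, f (Y₁ + Y₂) Z = f Y₁ Z + f Y₂ Z) (h₂ : ∀ (c : ℝ) Y Z, f (c • Y) Z = c * f Y Z)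
    (h₃ : ∀ Y Z₁ Z₂, f Y (Z₁ + Z₂) = f Y Z₁ + f Y Z₂) (h₄ : ∀ (c : ℝ) Y Z, f Y (c • Z) = c * f Y Z) :
    ∑ i, ∑ j, ginv G b x i j * f (b i) (b j) = ∑ i, ∑ j, ginv G b' x i j * f (b' i) (b' j) := by
  have h := mtrAt_eq_sum (G := G) (x := x) b (mkCLM₂ f h₁ h₂ h₃ h₄)
  have h' := mtrAt_eq_sum (G := G) (x := x) b' (mkCLM₂ f h₁ h₂ h₃ h₄)
  simp only [mkCLM₂_apply] at h h'
  rw [← h, ← h']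

/-- **The quadratic trace invariant is basis independent**:
`Σ g^{aa'} g^{cc'} tr(R(b_a,b_c) R(b_{a'},b_{c'}))` (`= −|Rm|²_G`, `rmNormSqAt_eq_sum`) has the same
value in any two bases. [cite: ONeill1983, Ch. 3, pp. 60–61] -/
theorem quadTrace_eq_of_basis :
    ∑ a, ∑ a', ∑ c, ∑ c', ginv G b x a a' * ginv G b x c c' *
        traceCLM E ((riemAt G x (b a) (b c)).comp (riemAt G x (b a') (b c'))) =
      ∑ a, ∑ a', ∑ c, ∑ c', ginv G b' x a a' * ginv G b' x c c' *
        traceCLM E ((riemAt G x (b' a) (b' c)).comp (riemAt G x (b' a') (b' c'))) := by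
  have h := rmNormSqAt_eq_sum (G := G) (x := x) b
  have h' := rmNormSqAt_eq_sum (G := G) (x := x) b'
  linarith

/-- The elementary cubic trace `t(X,X';Y,Y';Z,Z') = tr(R(X,Y) ∘ (R(Y',Z) ∘ R(Z',X')))` is additive
in `Z`. [folklore] -/
theorem traceCLM_riem₃_add₅ (X X' Y Y' Z₁ Z₂ Z' : E) :
    traceCLM E ((riemAt G x X Y).comp ((riemAt G x Y' (Z₁ + Z₂)).comp (riemAt G x Z' X'))) =
      traceCLM E ((riemAt G x X Y).comp ((riemAt G x Y' Z₁).comp (riemAt G x Z' X'))) +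
        traceCLM E ((riemAt G x X Y).comp ((riemAt G x Y' Z₂).comp (riemAt G x Z' X'))) := by
  rw [riemAt_add_right, ContinuousLinearMap.add_comp, ContinuousLinearMap.comp_add, map_add]

/-- `t` is homogeneous in `Z`. [folklore] -/
theorem traceCLM_riem₃_smul₅ (c : ℝ) (X X' Y Y' Z Z' : E) :
    traceCLM E ((riemAt G x X Y).comp ((riemAt G x Y' (c • Z)).comp (riemAt G x Z' X'))) =
      c * traceCLM E ((riemAt G x X Y).comp ((riemAt G x Y' Z).comp (riemAt G x Z' X'))) := by
  rw [riemAt_smul_right, ContinuousLinearMap.smul_comp, ContinuousLinearMap.comp_smul, map_smul,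
    smul_eq_mul]

/-- `t` is additive in `Z'`. [folklore] -/
theorem traceCLM_riem₃_add₆ (X X' Y Y' Z Z'₁ Z'₂ : E) :
    traceCLM E ((riemAt G x X Y).comp ((riemAt G x Y' Z).comp (riemAt G x (Z'₁ + Z'₂) X'))) =
      traceCLM E ((riemAt G x X Y).comp ((riemAt G x Y' Z).comp (riemAt G x Z'₁ X'))) +
        traceCLM E ((riemAt G x X Y).comp ((riemAt G x Y' Z).comp (riemAt G x Z'₂ X'))) := by
  rw [riemAt_add_left, ContinuousLinearMap.comp_add, ContinuousLinearMap.comp_add, map_add]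

/-- `t` is homogeneous in `Z'`. [folklore] -/
theorem traceCLM_riem₃_smul₆ (c : ℝ) (X X' Y Y' Z Z' : E) :
    traceCLM E ((riemAt G x X Y).comp ((riemAt G x Y' Z).comp (riemAt G x (c • Z') X'))) =
      c * traceCLM E ((riemAt G x X Y).comp ((riemAt G x Y' Z).comp (riemAt G x Z' X'))) := by
  rw [riemAt_smul_left, ContinuousLinearMap.comp_smul, ContinuousLinearMap.comp_smul, map_smul,
    smul_eq_mul]

/-- `t` is additive in `Y`. [folklore] -/
theorem traceCLM_riem₃_add₃ (X X' Y₁ Y₂ Y' Z Z' : E) :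
    traceCLM E ((riemAt G x X (Y₁ + Y₂)).comp ((riemAt G x Y' Z).comp (riemAt G x Z' X'))) =
      traceCLM E ((riemAt G x X Y₁).comp ((riemAt G x Y' Z).comp (riemAt G x Z' X'))) +
        traceCLM E ((riemAt G x X Y₂).comp ((riemAt G x Y' Z).comp (riemAt G x Z' X'))) := by
  rw [riemAt_add_right, ContinuousLinearMap.add_comp, map_add]

/-- `t` is homogeneous in `Y`. [folklore] -/
theorem traceCLM_riem₃_smul₃ (c : ℝ) (X X' Y Y' Z Z' : E) :
    traceCLM E ((riemAt G x X (c • Y)).comp ((riemAt G x Y' Z).comp (riemAt G x Z' X'))) =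
      c * traceCLM E ((riemAt G x X Y).comp ((riemAt G x Y' Z).comp (riemAt G x Z' X'))) := by
  rw [riemAt_smul_right, ContinuousLinearMap.smul_comp, map_smul, smul_eq_mul]

/-- `t` is additive in `Y'`. [folklore] -/
theorem traceCLM_riem₃_add₄ (X X' Y Y'₁ Y'₂ Z Z' : E) :
    traceCLM E ((riemAt G x X Y).comp ((riemAt G x (Y'₁ + Y'₂) Z).comp (riemAt G x Z' X'))) =
      traceCLM E ((riemAt G x X Y).comp ((riemAt G x Y'₁ Z).comp (riemAt G x Z' X'))) +
        traceCLM E ((riemAt G x X Y).comp ((riemAt G x Y'₂ Z).comp (riemAt G x Z' X'))) := by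
  rw [riemAt_add_left, ContinuousLinearMap.add_comp, ContinuousLinearMap.comp_add, map_add]

/-- `t` is homogeneous in `Y'`. [folklore] -/
theorem traceCLM_riem₃_smul₄ (c : ℝ) (X X' Y Y' Z Z' : E) :
    traceCLM E ((riemAt G x X Y).comp ((riemAt G x (c • Y') Z).comp (riemAt G x Z' X'))) =
      c * traceCLM E ((riemAt G x X Y).comp ((riemAt G x Y' Z).comp (riemAt G x Z' X'))) := by
  rw [riemAt_smul_left, ContinuousLinearMap.smul_comp, ContinuousLinearMap.comp_smul, map_smul,
    smul_eq_mul]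

/-- `t` is additive in `X`. [folklore] -/
theorem traceCLM_riem₃_add₁ (X₁ X₂ X' Y Y' Z Z' : E) :
    traceCLM E ((riemAt G x (X₁ + X₂) Y).comp ((riemAt G x Y' Z).comp (riemAt G x Z' X'))) =
      traceCLM E ((riemAt G x X₁ Y).comp ((riemAt G x Y' Z).comp (riemAt G x Z' X'))) +
        traceCLM E ((riemAt G x X₂ Y).comp ((riemAt G x Y' Z).comp (riemAt G x Z' X'))) := by
  rw [riemAt_add_left, ContinuousLinearMap.add_comp, map_add]

/-- `t` is homogeneous in `X`. [folklore] -/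
theorem traceCLM_riem₃_smul₁ (c : ℝ) (X X' Y Y' Z Z' : E) :
    traceCLM E ((riemAt G x (c • X) Y).comp ((riemAt G x Y' Z).comp (riemAt G x Z' X'))) =
      c * traceCLM E ((riemAt G x X Y).comp ((riemAt G x Y' Z).comp (riemAt G x Z' X'))) := by
  rw [riemAt_smul_left, ContinuousLinearMap.smul_comp, map_smul, smul_eq_mul]

/-- `t` is additive in `X'`. [folklore] -/
theorem traceCLM_riem₃_add₂ (X X'₁ X'₂ Y Y' Z Z' : E) :
    traceCLM E ((riemAt G x X Y).comp ((riemAt G x Y' Z).comp (riemAt G x Z' (X'₁ + X'₂)))) =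
      traceCLM E ((riemAt G x X Y).comp ((riemAt G x Y' Z).comp (riemAt G x Z' X'₁))) +
        traceCLM E ((riemAt G x X Y).comp ((riemAt G x Y' Z).comp (riemAt G x Z' X'₂))) := by
  rw [riemAt_add_right, ContinuousLinearMap.comp_add, ContinuousLinearMap.comp_add, map_add]

/-- `t` is homogeneous in `X'`. [folklore] -/
theorem traceCLM_riem₃_smul₂ (c : ℝ) (X X' Y Y' Z Z' : E) :
    traceCLM E ((riemAt G x X Y).comp ((riemAt G x Y' Z).comp (riemAt G x Z' (c • X')))) =
      c * traceCLM E ((riemAt G x X Y).comp ((riemAt G x Y' Z).comp (riemAt G x Z' X'))) := by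
  rw [riemAt_smul_right, ContinuousLinearMap.comp_smul, ContinuousLinearMap.comp_smul, map_smul,
    smul_eq_mul]

/-- Innermost contraction (over `Z, Z'`) is basis independent, the other four slots frozen.
[cite: ONeill1983, Ch. 3, pp. 60–61] -/
theorem cubicTrace_inner_eq_of_basis (X X' Y Y' : E) :
    ∑ e, ∑ e', ginv G b x e e' *
        traceCLM E ((riemAt G x X Y).comp ((riemAt G x Y' (b e)).comp (riemAt G x (b e') X'))) =
      ∑ e, ∑ e', ginv G b' x e e' *
        traceCLM E ((riemAt G x X Y).comp ((riemAt G x Y' (b' e)).comp (riemAt G x (b' e') X'))) :=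
  sum_ginv_mul_eq_of_bilinear G b b' x
    (fun Z Z' ↦ traceCLM E ((riemAt G x X Y).comp ((riemAt G x Y' Z).comp (riemAt G x Z' X'))))
    (fun Z₁ Z₂ Z' ↦ traceCLM_riem₃_add₅ G x X X' Y Y' Z₁ Z₂ Z')
    (fun c Z Z' ↦ traceCLM_riem₃_smul₅ G x c X X' Y Y' Z Z')
    (fun Z Z'₁ Z'₂ ↦ traceCLM_riem₃_add₆ G x X X' Y Y' Z Z'₁ Z'₂)
    (fun c Z Z' ↦ traceCLM_riem₃_smul₆ G x c X X' Y Y' Z Z')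

/-- Middle contraction (over `Y, Y'`, the inner one already summed in the basis `b'`) is basis
independent, the slots `X, X'` frozen. [cite: ONeill1983, Ch. 3, pp. 60–61] -/
theorem cubicTrace_middle_eq_of_basis (X X' : E) :
    ∑ c, ∑ c', ginv G b x c c' * ∑ e, ∑ e', ginv G b' x e e' *
        traceCLM E ((riemAt G x X (b c)).comp ((riemAt G x (b c') (b' e)).comp (riemAt G x (b' e') X'))) =
      ∑ c, ∑ c', ginv G b' x c c' * ∑ e, ∑ e', ginv G b' x e e' *
        traceCLM E ((riemAt G x X (b' c)).comp
          ((riemAt G x (b' c') (b' e)).comp (riemAt G x (b' e') X'))) := by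
  refine sum_ginv_mul_eq_of_bilinear G b b' x
    (fun Y Y' ↦ ∑ e, ∑ e', ginv G b' x e e' *
      traceCLM E ((riemAt G x X Y).comp ((riemAt G x Y' (b' e)).comp (riemAt G x (b' e') X'))))
    ?_ ?_ ?_ ?_
  · intro Y₁ Y₂ Y'
    simp only [traceCLM_riem₃_add₃, mul_add, Finset.sum_add_distrib]
  · intro c Y Y'
    simp only [traceCLM_riem₃_smul₃, Finset.mul_sum]
    exact Finset.sum_congr rfl fun e _ ↦ Finset.sum_congr rfl fun e' _ ↦ by ring
  · intro Y Y'₁ Y'₂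
    simp only [traceCLM_riem₃_add₄, mul_add, Finset.sum_add_distrib]
  · intro c Y Y'
    simp only [traceCLM_riem₃_smul₄, Finset.mul_sum]
    exact Finset.sum_congr rfl fun e _ ↦ Finset.sum_congr rfl fun e' _ ↦ by ring

/-- Outer contraction (over `X, X'`, the inner two already summed in the basis `b'`) is basis
independent. [cite: ONeill1983, Ch. 3, pp. 60–61] -/
theorem cubicTrace_outer_eq_of_basis :
    ∑ a, ∑ a', ginv G b x a a' * ∑ c, ∑ c', ginv G b' x c c' * ∑ e, ∑ e', ginv G b' x e e' *
        traceCLM E ((riemAt G x (b a) (b' c)).comp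
          ((riemAt G x (b' c') (b' e)).comp (riemAt G x (b' e') (b a')))) =
      ∑ a, ∑ a', ginv G b' x a a' * ∑ c, ∑ c', ginv G b' x c c' * ∑ e, ∑ e', ginv G b' x e e' *
        traceCLM E ((riemAt G x (b' a) (b' c)).comp
          ((riemAt G x (b' c') (b' e)).comp (riemAt G x (b' e') (b' a')))) := by
  refine sum_ginv_mul_eq_of_bilinear G b b' x
    (fun X X' ↦ ∑ c, ∑ c', ginv G b' x c c' * ∑ e, ∑ e', ginv G b' x e e' *
      traceCLM E ((riemAt G x X (b' c)).comp
        ((riemAt G x (b' c') (b' e)).comp (riemAt G x (b' e') X'))))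
    ?_ ?_ ?_ ?_
  · intro X₁ X₂ X'
    simp only [traceCLM_riem₃_add₁, mul_add, Finset.sum_add_distrib]
  · intro c X X'
    simp only [traceCLM_riem₃_smul₁, Finset.mul_sum]
    exact Finset.sum_congr rfl fun i _ ↦ Finset.sum_congr rfl fun i' _ ↦
      Finset.sum_congr rfl fun e _ ↦ Finset.sum_congr rfl fun e' _ ↦ by ring
  · intro X X'₁ X'₂
    simp only [traceCLM_riem₃_add₂, mul_add, Finset.sum_add_distrib]
  · intro c X X'
    simp only [traceCLM_riem₃_smul₂, Finset.mul_sum]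
    exact Finset.sum_congr rfl fun i _ ↦ Finset.sum_congr rfl fun i' _ ↦
      Finset.sum_congr rfl fun e _ ↦ Finset.sum_congr rfl fun e' _ ↦ by ring

/-- Regrouping of the flat sextuple sum into three nested metric contractions. [folklore] -/
theorem cubicTrace_eq_nested :
    ∑ a, ∑ a', ∑ c, ∑ c', ∑ e, ∑ e',
        ginv G b x a a' * ginv G b x c c' * ginv G b x e e' *
        traceCLM E ((riemAt G x (b a) (b c)).comp
          ((riemAt G x (b c') (b e)).comp (riemAt G x (b e') (b a')))) =
      ∑ a, ∑ a', ginv G b x a a' * ∑ c, ∑ c', ginv G b x c c' * ∑ e, ∑ e', ginv G b x e e' *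
        traceCLM E ((riemAt G x (b a) (b c)).comp
          ((riemAt G x (b c') (b e)).comp (riemAt G x (b e') (b a')))) := by
  simp only [Finset.mul_sum]
  exact Finset.sum_congr rfl fun a _ ↦ Finset.sum_congr rfl fun a' _ ↦
    Finset.sum_congr rfl fun c _ ↦ Finset.sum_congr rfl fun c' _ ↦
    Finset.sum_congr rfl fun e _ ↦ Finset.sum_congr rfl fun e' _ ↦ by ring

/-- **The cubic trace invariant is basis independent**:
`Σ g^{aa'} g^{cc'} g^{ee'} tr(R(b_a,b_c) ∘ (R(b_{c'},b_e) ∘ R(b_{e'},b_{a'})))` — the index pattern of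
`cubicTrace_pullMetric` and of the cubic Weyl invariant of Kerr — has the same value in any two
bases of `E` (three metric contractions, each a trace). [cite: ONeill1983, Ch. 3, pp. 60–61] -/
theorem cubicTrace_eq_of_basis :
    ∑ a, ∑ a', ∑ c, ∑ c', ∑ e, ∑ e',
        ginv G b x a a' * ginv G b x c c' * ginv G b x e e' *
        traceCLM E ((riemAt G x (b a) (b c)).comp
          ((riemAt G x (b c') (b e)).comp (riemAt G x (b e') (b a')))) =
      ∑ a, ∑ a', ∑ c, ∑ c', ∑ e, ∑ e',
        ginv G b' x a a' * ginv G b' x c c' * ginv G b' x e e' *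
        traceCLM E ((riemAt G x (b' a) (b' c)).comp
          ((riemAt G x (b' c') (b' e)).comp (riemAt G x (b' e') (b' a')))) := by
  rw [cubicTrace_eq_nested G b x, cubicTrace_eq_nested G b' x]
  -- innermost pair `(e, e')` : `b ↦ b'`
  have h1 : ∀ a a' c c', ∑ e, ∑ e', ginv G b x e e' *
      traceCLM E ((riemAt G x (b a) (b c)).comp
        ((riemAt G x (b c') (b e)).comp (riemAt G x (b e') (b a')))) =
      ∑ e, ∑ e', ginv G b' x e e' *
      traceCLM E ((riemAt G x (b a) (b c)).comp
        ((riemAt G x (b c') (b' e)).comp (riemAt G x (b' e') (b a')))) :=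
    fun a a' c c' ↦ cubicTrace_inner_eq_of_basis G b b' x (b a) (b a') (b c) (b c')
  simp_rw [h1]
  -- middle pair `(c, c')`
  have h2 : ∀ a a', ∑ c, ∑ c', ginv G b x c c' * ∑ e, ∑ e', ginv G b' x e e' *
      traceCLM E ((riemAt G x (b a) (b c)).comp
        ((riemAt G x (b c') (b' e)).comp (riemAt G x (b' e') (b a')))) =
      ∑ c, ∑ c', ginv G b' x c c' * ∑ e, ∑ e', ginv G b' x e e' *
      traceCLM E ((riemAt G x (b a) (b' c)).comp
        ((riemAt G x (b' c') (b' e)).comp (riemAt G x (b' e') (b a')))) :=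
    fun a a' ↦ cubicTrace_middle_eq_of_basis G b b' x (b a) (b a')
  simp_rw [h2]
  -- outer pair `(a, a')`
  exact cubicTrace_outer_eq_of_basis G b b' x

end MetricCoord

end Literature.Geometry.Lorentzian

end
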